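import Literature.Topology.FourManifolds.PlanarPageSmooth
import Literature.Topology.FourManifolds.AchiralLefschetzModel
import HarnessLib

/-!
# Planar Lefschetz bodies `X(P_n; w)` and planar word manifolds `X̂(P_n; w)` of a word of the
# planar curve calculus

Topic `Literature/Topology/FourManifolds`.  Definitions only (three predicates and one loop);
NOTHING is asserted.  Bricks D-b and D-d of the vocabulary programme G3 of the crux
`ConvexBisection.PlanarAcyclicBisectionRigidity`
(`Summits/SmoothPoincare4/SmoothPoincare4/Cruxes/PlanarAcyclicBisectionRigidity/DictionaryDesign.md`
§4 items 3–4), which make the dictionary facts of that crux (Wendl 2010 Thm 1 read in words;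
Gompf–Stipsicz §8.2 Hurwitz invariance; Etnyre–Fuller stabilisation; Loi–Piergallini 2001;
Baykur 2006 Thm 5.1) STATABLE over the registered syntactic calculus
`Literature.Topology.FourManifolds.PlanarWords` (`PlanarAchiralWords.lean`: `PlanarCurve`,
`Letter = PlanarCurve × Bool`, `cls`, `monodromy`, `Move`, …).

## Design: thin specialisations of the tree's general Lefschetz-handlebody vocabulary

The tree already has, for an ARBITRARY compact oriented smooth page `(P, o)` and a word of
honest signed cycles `w : List (SignedCycle P)` (annulus charts + signs), the relational
predicates `IsLefschetzHandlebodyOver P o w W` — *`W` is the achiral Lefschetz handlebody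
`X(P; w)`* (Kas 1980; Gompf–Stipsicz 1999 §8.2; Etnyre–Fuller 2006 §2) — and
`IsAchiralLefschetzModel P o w X` — *`X` is the closed model `X̂(P; w) = X(P; w) ∪ (1-handlebody)`*
(`AchiralLefschetzModel.lean`, with its faithfulness audit (1)–(4)).  This file does NOT build a
parallel vocabulary; it only

* fixes the page: the smooth oriented model planar page `SmoothPlanarPage n` (the disc with `n`
  round holes as a regular sublevel set in `𝔼²`, oriented from the standard orientation of `𝔼²`,
  `PlanarPageSmooth.lean`), homeomorphic by `SmoothPlanarPage.toPlanarPage` to the topological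
  model `PlanarPage n ⊂ ℂ` on which the lassos `x_j` and the loop classes `wordClass n w` of words
  `w ∈ F_n` live (`PlanarPage.lean`);
* says which SYNTACTIC letter a signed cycle realises: `SignedCycle.Realises n c γ` — the core
  curve of `γ`, read in `PlanarPage n`, is freely homotopic to the loop spelled by the class
  `PlanarCurve.cls n c ∈ F_n` of the syntactic curve `c = g(c_[a,b])` (free homotopy = conjugacy
  of based classes: the tail `η` from the base point is quantified, so only the conjugacy class of
  `cls n c` matters, as `PlanarAchiralWords.lean` promises: "well defined up to conjugacy, which is
  all that is used"); `RealisesLetter` adds the sign;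
* and specialises: `IsPlanarLefschetzBody X n w` (D-b) := some family of signed cycles realising
  the letters of `w`, in order, makes `X` the Lefschetz handlebody over the model page;
  `IsPlanarWordManifold M n w` (D-d) := the same with the closed model.

## Faithfulness (for the auditor)

(a) CURVES.  On a surface, homotopic essential simple closed curves are isotopic (Baer; Farb–
Margalit 2012, Prop. 1.10), and a simple closed curve in the interior of `P_n` is essential or
bounds a disc or is parallel to a boundary circle — in all cases its isotopy class is determined
by its free homotopy class, i.e. by the conjugacy class of `cls n c`; so `Realises` names the
isotopy class of the vanishing cycle WITHOUT realising words as homeomorphisms, exactly as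
DictionaryDesign.md §4 item 3 prescribes.  The direction in which the core is traversed is fixed
(`t ↦ γ.curve (e^{2πit})`); a Dehn twist does not depend on the orientation of its curve, and an
annulus chart may be precomposed with the orientation-preserving involution `(x, s) ↦ (x̄, -s)` of
`𝕊¹ × ℝ` (same image annulus, reversed core) without changing the handle it describes, so fixing
the direction loses no body.  (b) ORDER.  The `i`-th letter of `w` is the `i`-th cycle of
`List.ofFn γ`; `AchiralLefschetzModel.lean` (Faithfulness (4)) reads the boundary monodromy as
`t_{c₀}^{ε₀} ∘ ⋯ ∘ t_{c_{k-1}}^{ε_{k-1}}`, first letter outermost — the convention of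
`PlanarWords.monodromy` ("first letter outermost").  (c) CHIRALITY.  A positive letter `(c, true)`
is a cycle with `pos = true`, i.e. framing `pf − 1`, a positive Lefschetz critical point, whose
monodromy is the RIGHT-handed twist for the page orientation `o`; here `o` is induced from the
standard orientation of `𝔼² ≅ ℂ` (`Complex.orthonormalBasisOneI`: `1 ↦ e₀`, `i ↦ e₁`, orientation
preserving), and the positive generator `T_[a,b]` of `PlanarWords` (`PGen.round a b false`) is the
right-handed twist of the complex orientation (DictionaryDesign.md §2, Decision 2: the arc `δ_i`
turning right picks up `x_a ⋯ x_b · δ_i = PGen.data n (round a b false)`).  A global error in (c)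
would replace every statement over this vocabulary by the one for the mirror word; (c) is the one
place to audit, and it is the same audit as `AchiralLefschetzModel.lean` (4).  (d) The predicates
are invariant under re-spelling a letter by another syntactic curve with conjugate class (same
free homotopy class), in particular under `TwistEq`-replacement once arc data are known faithful
(cite fact F0, Alexander method) — nothing of that is asserted here.

## References
* A. Kas, *On the handlebody decomposition associated to a Lefschetz fibration*, Pacific J. Math.
  89 (1980), 89–104. [Kas1980]
* R. E. Gompf, A. I. Stipsicz, *4-Manifolds and Kirby Calculus*, GSM 20 (1999), §8.2.
  [GompfStipsiczGSM1999]
* J. B. Etnyre, T. Fuller, *Realizing 4-manifolds as achiral Lefschetz fibrations*, IMRN 2006, §2.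
  [EtnyreFuller2006]
* B. Farb, D. Margalit, *A Primer on Mapping Class Groups* (2012), §1.2.3 (free homotopy classes
  and isotopy of curves), §1.3. [FarbMargalit2012]
-/

noncomputable section

open Set Function
open scoped unitInterval

namespace Literature.Topology.FourManifolds

open PlanarWords (PlanarCurve Letter)

universe u

variable {n : ℕ}

namespace SignedCycle

/-- **The core of a signed cycle on the smooth model page, read as a loop in the topological page
`PlanarPage n`**: `t ↦ toPlanarPage (γ.curve (e^{2πit}))`, `t ∈ [0, 1]`, a closed path at the
image of the core point of angle `0` (given continuity of the core, which every cycle of a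
Lefschetz link has). [folklore] -/
def pageLoop (γ : SignedCycle (SmoothPlanarPage n)) (hγ : Continuous γ.curve) :
    Path (SmoothPlanarPage.toPlanarPage n (γ.curve (circlePt 0)))
      (SmoothPlanarPage.toPlanarPage n (γ.curve (circlePt 0))) where
  toFun t := SmoothPlanarPage.toPlanarPage n (γ.curve (circlePt t))
  continuous_toFun := (SmoothPlanarPage.toPlanarPage n).continuous.comp
    (hγ.comp (continuous_circlePt.comp continuous_subtype_val))
  source' := rfl
  target' := by
    change SmoothPlanarPage.toPlanarPage n (γ.curve (circlePt 1)) = _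
    rw [show (1 : ℝ) = 0 + 1 by norm_num, circlePt_add_one]

/-- **The signed cycle `γ` REALISES the syntactic planar curve `c`** (`c = g(c_[a,b])`,
`PlanarAchiralWords.lean`) on the page with `n` holes: the core of `γ` is continuous and, read in
the topological page, is FREELY homotopic to the loop spelled in the lassos by the class
`PlanarCurve.cls n c ∈ F_n` — i.e. for some path `η` from the base point `p₀` to the start of the
core, the loop `η · γ · η⁻¹` at `p₀` is homotopic rel end points to `wordClass n (cls n c)`.  Since
`η` is quantified, only the conjugacy class of `cls n c` (the free homotopy class of the curve)
matters; by Baer's theorem this pins down the isotopy class of the vanishing cycle.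
[cite: FarbMargalit2012, §1.2.3] -/
def Realises (n : ℕ) (c : PlanarCurve) (γ : SignedCycle (SmoothPlanarPage n)) : Prop :=
  ∃ (hγ : Continuous γ.curve)
    (η : Path (PlanarPage.basePoint n) (SmoothPlanarPage.toPlanarPage n (γ.curve (circlePt 0)))),
    (Path.Homotopic.Quotient.mk (η.trans ((γ.pageLoop hγ).trans η.symm)) :
        Path.Homotopic.Quotient (PlanarPage.basePoint n) (PlanarPage.basePoint n)) =
      PlanarPage.wordClass n (PlanarCurve.cls n c)

/-- **The signed cycle `γ` realises the signed LETTER `l = (c, ε)`**: it realises the curve `c`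
and carries the sign `ε` (`true` = positive Lefschetz handle, framing `pf − 1`, right-handed
twist). [folklore] -/
def RealisesLetter (n : ℕ) (l : Letter) (γ : SignedCycle (SmoothPlanarPage n)) : Prop :=
  γ.pos = l.2 ∧ γ.Realises n l.1

end SignedCycle

/-- **D-b: `X` is the PLANAR LEFSCHETZ BODY `X(P_n; w)` of the word `w`** of the planar curve
calculus: there is a family of signed cycles on the smooth model page `SmoothPlanarPage n`, the
`i`-th realising the `i`-th letter of `w` (curve up to isotopy, and sign), which makes `X` the
achiral Lefschetz handlebody over the model page with its standard orientation
(`IsLefschetzHandlebodyOver`, `AchiralLefschetzModel.lean`: a compact connected orientable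
1-handlebody whose boundary open book has pages parametrised by the page, plus one 2-handle per
letter along the cycle pushed into its own page with framing `pf ∓ 1`).  For a positive word
`w = positiveWord A` this is the total space of the PALF over `D²` with planar fibre `P_n` and
vanishing cycles `A` (Kas 1980; Gompf–Stipsicz 1999 §8.2). [cite: Kas1980] -/
def IsPlanarLefschetzBody (X : Type u) [TopologicalSpace X] [ChartedSpace (EuclideanHalfSpace 4) X]
    (n : ℕ) (w : List Letter) : Prop :=
  ∃ γ : Fin w.length → SignedCycle (SmoothPlanarPage n),
    (∀ i, (γ i).RealisesLetter n (w.get i)) ∧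
      IsLefschetzHandlebodyOver (SmoothPlanarPage n) (SmoothPlanarPage.orientation n) (List.ofFn γ) X

/-- **D-d: `M` is the PLANAR WORD MANIFOLD `X̂(P_n; w)` of the word `w`**: a family of signed
cycles on the smooth model page realising the letters of `w` makes `M` the closed achiral
Lefschetz model over the model page (`IsAchiralLefschetzModel`, `AchiralLefschetzModel.lean`:
`M = X(P_n; w) ∪_Ψ V` for a compact connected orientable 1-handlebody `V` and SOME boundary
diffeomorphism `Ψ`, on which the manifold does not depend by Laudenbach–Poénaru).  For an achiral
factorisation of the identity — e.g. the block form `A · B̄ʳᵉᵛ` of two positive factorisations of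
one mapping class — this is `X(P_n; w) ∪ (P_n × D²)`, the achiral Lefschetz fibration over `S²`
with fibre `P_n` closed off, i.e. `X_A ∪ X̄_B` (Gompf–Stipsicz 1999 §8.2; Baykur 2006 Thm 5.1).
[cite: GompfStipsiczGSM1999, §8.2] -/
def IsPlanarWordManifold (M : Type u) [TopologicalSpace M]
    [ChartedSpace (EuclideanSpace ℝ (Fin 4)) M] (n : ℕ) (w : List Letter) : Prop :=
  ∃ γ : Fin w.length → SignedCycle (SmoothPlanarPage n),
    (∀ i, (γ i).RealisesLetter n (w.get i)) ∧
      IsAchiralLefschetzModel (SmoothPlanarPage n) (SmoothPlanarPage.orientation n) (List.ofFn γ) M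

/-! ### API (bookkeeping only) -/

/-- A planar word manifold is a closed achiral Lefschetz model over the model page for SOME word
of signed cycles of the same length (forget which letters are realised). [folklore] -/
theorem IsPlanarWordManifold.exists_isAchiralLefschetzModel {M : Type u} [TopologicalSpace M]
    [ChartedSpace (EuclideanSpace ℝ (Fin 4)) M] {n : ℕ} {w : List Letter}
    (h : IsPlanarWordManifold M n w) :
    ∃ v : List (SignedCycle (SmoothPlanarPage n)), v.length = w.length ∧
      IsAchiralLefschetzModel (SmoothPlanarPage n) (SmoothPlanarPage.orientation n) v M := by
  obtain ⟨γ, -, hM⟩ := h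
  exact ⟨List.ofFn γ, List.length_ofFn, hM⟩

/-- A planar word manifold is compact (it is a closed gluing of two compact pieces). [folklore] -/
theorem IsPlanarWordManifold.compactSpace {M : Type u} [TopologicalSpace M]
    [ChartedSpace (EuclideanSpace ℝ (Fin 4)) M] {n : ℕ} {w : List Letter}
    (h : IsPlanarWordManifold M n w) : CompactSpace M := by
  obtain ⟨γ, -, hM⟩ := h
  exact hM.compactSpace

/-- A planar Lefschetz body is a Lefschetz handlebody over the model page for SOME word of signed
cycles of the same length; in particular it is a 1-handlebody with `w.length` 2-handles attached
(`IsLefschetzHandlebodyOver.exists_isMultiAttachment`). [folklore] -/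
theorem IsPlanarLefschetzBody.exists_isLefschetzHandlebodyOver {X : Type u} [TopologicalSpace X]
    [ChartedSpace (EuclideanHalfSpace 4) X] {n : ℕ} {w : List Letter}
    (h : IsPlanarLefschetzBody X n w) :
    ∃ v : List (SignedCycle (SmoothPlanarPage n)), v.length = w.length ∧
      IsLefschetzHandlebodyOver (SmoothPlanarPage n) (SmoothPlanarPage.orientation n) v X := by
  obtain ⟨γ, -, hX⟩ := h
  exact ⟨List.ofFn γ, List.length_ofFn, hX⟩

end Literature.Topology.FourManifolds

end
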